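import Summits.BirchSwinnertonDyer.BirchSwinnertonDyer.Theses.TameQuarticManinParity
import Literature.NumberTheory.EllipticCurves.ModThreeReducibleIffPsi3Root
import HarnessLib

/-!
# Route `TameQuarticManinParity`, LINE 21 (bsd-idea-3 g7), support R3 `ReducibleModThreeHasRationalKernel`
# (stmt-BirchSwinnertonDyer-27957) — PROVED BY NAME from the tree's `3`-division-polynomial criterion

Cell `pub/bsd-wall`, D-0145 line `route-BirchSwinnertonDyer-TeichmullerTwistDescent`, seat `bsd-line-ttd-p1` g9,
working the planner-of-record's TQMP LINE 21. BSD is NOT proved by this; Manin's conjecture is not proved by this.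

## Statement (verbatim the route decl)

`∀ W elliptic over ℚ, ¬ W.HasIrreducibleModPGaloisRep 3 → ∃ x₀ : ℚ, W.Ψ₃.eval x₀ = 0`.

## Proof

The tree's `WeierstrassCurve.not_hasIrreducibleModPGaloisRep_three_iff_exists_isRoot_Ψ₃` (Cremona §3.8, Silverman
*AEC* III.4.12 / Ex. 3.7: a `Γ_ℚ`-stable line `{O, ±P} ⊂ E[3]` has `x(P) ∈ ℚ` a root of `Ψ₃`), read through
`Polynomial.IsRoot`. Design: theorems only; no definition, no named fact, no `sorry`; axioms `propext`,
`Classical.choice`, `Quot.sound`.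
-/

set_option autoImplicit false
-- D-0017: single-problem summit, so `Summit.BirchSwinnertonDyer.BirchSwinnertonDyer.…` repeats a namespace BY DESIGN.
set_option linter.dupNamespace false

namespace Summit.BirchSwinnertonDyer.BirchSwinnertonDyer.Theorems.TameQuarticManinParity

open Summit.BirchSwinnertonDyer.BirchSwinnertonDyer.Theses.TameQuarticManinParity

/-- **R3 `ReducibleModThreeHasRationalKernel`** (stmt-BirchSwinnertonDyer-27957), by name: a reducible `E[3]`
gives a rational root of the `3`-division polynomial `Ψ₃` (the abscissa of the stable line `{O, ±P}`).
[cite: SilvermanAEC2009, III.4.12, Remark III.4.13.2 and Exercise 3.7] [cite: Cremona1997, §3.8 (l = 3)] -/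
theorem reducibleModThreeHasRationalKernel_proof : ReducibleModThreeHasRationalKernel := by
  intro W _ hred
  obtain ⟨x₀, hx₀⟩ := W.not_hasIrreducibleModPGaloisRep_three_iff_exists_isRoot_Ψ₃.mp hred
  exact ⟨x₀, hx₀⟩

end Summit.BirchSwinnertonDyer.BirchSwinnertonDyer.Theorems.TameQuarticManinParity
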